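import Summits.CriticalPhenomena.PercolationContinuityZ3.Theorems.PercNearOneGluingNoHeavyLowerTailCondPackingOne
import Summits.CriticalPhenomena.PercolationContinuityZ3.Theorems.PercNearOneGluingNoHeavyLowerTailLonelyRelay
import HarnessLib

/-!
# `NoHeavyLowerTail` (stmt-CriticalPhenomena-4575) — QG⁺ at level one: the quantitative gap with the ATTACHED runner-up weight

Support file (lemma factory #8 `prim-lf-8`, gen 5; `--supports stmt-CriticalPhenomena-4575`).  No definitions, no named facts,
no sorries.  `μ = prodBernoulli w` on `Fin n`, relays `A`, observer `o`, `N = |{a ∈ A : o ↔ a}|`, `D_x = {x ↮ A ∖ x}`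
(`= {|π(x)| ≤ 1}`), `U = {o ↔ A}`.

The member QG⁺ of the QG family (run/shared/lean/prim/prim-lf-8/QG-FAMILY-ROOT.md §1b; census lf8qg: 0 violations in
1.70e9 multigraphs + 2.86 M weighted champion cases) reads at level `j`:
`μ(1 ≤ N ≤ j) ≤ μ(o ↔ c)·S(c) + (μ(N ≥ 1) − μ(o ↔ c))·S₂` — the quantitative gap QG with the runner-up weight `μ(o ↮ c)`
replaced by the smaller ATTACHED weight `μ(N ≥ 1) − μ(o ↔ c) = μ(o ↔ A, o ↮ c)`.  It sits between the KN-Conj-1-hard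
top-weighted packing U and QG.  This file proves its LEVEL ONE at champions, for every `|A|`:

* `quantGapPlus_one` — for `c ∈ A`, `0 ≤ t`, `μ(D_a) ≤ t ≤ μ(D_c)` (`a ≠ c`) and every `μ(D_x) > 0`:
  `μ(N = 1) ≤ μ(o ↔ c)·μ(D_c) + (μ(U) − μ(o ↔ c))·t`.

Proof: Kozma–Nitzan's packing `Σ_x μ(o↔x | D_x) ≤ μ(U)` (from the tree's conditioned form `condPacking_one`,
`μ(D_c)·Σ ≤ μ(D_c ∩ U)`, and Harris `μ(D_c ∩ U) ≤ μ(D_c)·μ(U)`), the cover `{N = 1} ⊆ ⋃_x {o↔x} ∩ D_x`, the bound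
`μ({o↔x} ∩ D_x) ≤ t·μ(o↔x | D_x)` for `x ≠ c`, and Harris `μ({o↔c} ∩ D_c) ≤ μ(o↔c)·μ(D_c)` together with `t ≤ μ(D_c)`:
`μ(N=1) ≤ e_c + t·(μ(U) − e_c/μ(D_c)) = t·μ(U) + e_c·(1 − t/μ(D_c)) ≤ t·μ(U) + μ(o↔c)·(μ(D_c) − t)`.
The champion hypothesis `t ≤ μ(D_c)` is essential: the any-`c` form fails at non-champions already at level one
(seat screen lab/qgplus_anyc.py: 3 704 / 23 966 random cases, all at non-champions; 0 at champions).
-/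

noncomputable section

namespace Summit.CriticalPhenomena.PercolationContinuityZ3.Theorems

open MeasureTheory Set Literature.Probability.LatticeModels Literature.Probability.Percolation
open scoped Classical BigOperators

variable {n : ℕ}

namespace QuantGapPlusOne

/-- `D_x = {x ↮ T}` is decreasing. [folklore] -/
theorem isLowerSet_notConn (T : Finset (Fin n)) (x : Fin n) :
    IsLowerSet {ω : BondConfig (Fin n) | ∀ t ∈ T, ω ∉ openConn x t} :=
  fun _ _ hle hω t ht h => hω t ht (isUpperSet_openConn x t hle h)

/-- `U = {o ↔ A}` is increasing. [folklore] -/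
theorem isUpperSet_touch (A : Finset (Fin n)) (o : Fin n) :
    IsUpperSet (⋃ a ∈ A, (openConn o a : Set (BondConfig (Fin n)))) := by
  intro ω ω' hle hω
  obtain ⟨a, ha, hωa⟩ := Set.mem_iUnion₂.1 hω
  exact Set.mem_iUnion₂.2 ⟨a, ha, isUpperSet_openConn o a hle hωa⟩

/-- **Kozma–Nitzan's Lemma 2 with singleton blocks** (`Σ_x μ(o ↔ x | x ↮ A∖x) ≤ μ(o ↔ A)`), from the conditioned form
`condPacking_one` and Harris. [cite: KozmaNitzan2024, Lemma 2 (p. 6)] -/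
theorem packing_le_touch (w : Sym2 (Fin n) → unitInterval) (A : Finset (Fin n)) (o c : Fin n) (hc : c ∈ A)
    (hpos : ∀ x ∈ A, 0 < (prodBernoulli w).real {ω | ∀ t ∈ A.erase x, ω ∉ openConn x t}) :
    ∑ x ∈ A, (prodBernoulli w).real (openConn o x ∩ {ω | ∀ t ∈ A.erase x, ω ∉ openConn x t}) /
        (prodBernoulli w).real {ω | ∀ t ∈ A.erase x, ω ∉ openConn x t} ≤
      (prodBernoulli w).real (⋃ a ∈ A, (openConn o a : Set (BondConfig (Fin n)))) := by
  set μ := prodBernoulli w with hμ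
  set Dc : Set (BondConfig (Fin n)) := {ω | ∀ t ∈ A.erase c, ω ∉ openConn c t} with hDc
  set U : Set (BondConfig (Fin n)) := ⋃ a ∈ A, (openConn o a : Set (BondConfig (Fin n))) with hU
  have hpack := condPacking_one n w A o c hc hpos
  have hharris : μ.real (Dc ∩ U) ≤ μ.real Dc * μ.real U := by
    rw [Set.inter_comm, mul_comm]
    exact prodBernoulli_harris_upper_lower w (isUpperSet_touch A o) (isLowerSet_notConn (A.erase c) c)
      MeasurableSet.of_discrete MeasurableSet.of_discrete
  have hDpos : 0 < μ.real Dc := hpos c hc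
  have key : μ.real Dc * (∑ x ∈ A, μ.real (openConn o x ∩ {ω | ∀ t ∈ A.erase x, ω ∉ openConn x t}) /
      μ.real {ω | ∀ t ∈ A.erase x, ω ∉ openConn x t}) ≤ μ.real Dc * μ.real U := hpack.trans hharris
  exact le_of_mul_le_mul_left key hDpos

end QuantGapPlusOne

open QuantGapPlusOne

/-- **QG⁺ AT LEVEL ONE** (all `|A|`, champions).  For bond percolation with arbitrary edge probabilities on `Fin n`, an
observer `o`, relays `A` with `μ(x ↮ A∖x) > 0` for every `x ∈ A`, a relay `c ∈ A` and a threshold `t ≥ 0` with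
`μ(a ↮ A∖a) ≤ t ≤ μ(c ↮ A∖c)` for `a ∈ A ∖ c` (e.g. `c` the loneliest relay and `t` the runner-up value):
  `μ(N = 1) ≤ μ(o ↔ c)·μ(c ↮ A∖c) + (μ(o ↔ A) − μ(o ↔ c))·t`.
This sharpens `Theorems.quantGapOne` (weight `1 − μ(o↔c)` there) by the unattached mass `μ(o ↮ A)·t`.
[cite: KozmaNitzan2024, Lemma 2 (p. 6); VandenbergHaggstromKahn2005, Thm. 1.3 (p. 6) — corollary] -/
theorem quantGapPlus_one (n : ℕ) (w : Sym2 (Fin n) → unitInterval) (A : Finset (Fin n)) (o c : Fin n)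
    (hc : c ∈ A) (t : ℝ) (ht : 0 ≤ t)
    (hiso : ∀ a ∈ A, a ≠ c → (prodBernoulli w).real {ω | ∀ t ∈ A.erase a, ω ∉ openConn a t} ≤ t)
    (htc : t ≤ (prodBernoulli w).real {ω | ∀ t ∈ A.erase c, ω ∉ openConn c t})
    (hpos : ∀ x ∈ A, 0 < (prodBernoulli w).real {ω | ∀ t ∈ A.erase x, ω ∉ openConn x t}) :
    (prodBernoulli w).real
        {ω : Set (Sym2 (Fin n)) | (A.filter fun a => ω ∈ openConn o a).card = 1} ≤
      (prodBernoulli w).real (openConn o c) *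
          (prodBernoulli w).real {ω | ∀ t ∈ A.erase c, ω ∉ openConn c t} +
        ((prodBernoulli w).real (⋃ a ∈ A, (openConn o a : Set (BondConfig (Fin n)))) -
          (prodBernoulli w).real (openConn o c)) * t := by
  set μ := prodBernoulli w with hμ
  set D : Fin n → Set (BondConfig (Fin n)) := fun x => {ω | ∀ t ∈ A.erase x, ω ∉ openConn x t} with hD
  set e : Fin n → ℝ := fun x => μ.real (openConn o x ∩ D x) with he
  set r : Fin n → ℝ := fun x => μ.real (D x) with hr
  set U : Set (BondConfig (Fin n)) := ⋃ a ∈ A, (openConn o a : Set (BondConfig (Fin n))) with hU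
  have hr0 : ∀ x ∈ A, 0 < r x := hpos
  have he0 : ∀ x, 0 ≤ e x := fun _ => measureReal_nonneg
  -- (1) cover
  have hcover : μ.real {ω : Set (Sym2 (Fin n)) | (A.filter fun a => ω ∈ openConn o a).card = 1} ≤ ∑ x ∈ A, e x :=
    (measureReal_mono (lonelyRelay_subset_biUnion A o) (measure_ne_top _ _)).trans
      (measureReal_biUnion_finset_le A _)
  -- (2) packing
  have hpack : ∑ x ∈ A, e x / r x ≤ μ.real U := packing_le_touch w A o c hc hpos
  -- (3) non-champion terms: `e x ≤ t · (e x / r x)`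
  have hterm : ∀ x ∈ A.erase c, e x ≤ t * (e x / r x) := by
    intro x hx
    obtain ⟨hxc, hxA⟩ := Finset.mem_erase.1 hx
    have hrx : 0 < r x := hr0 x hxA
    calc e x = r x * (e x / r x) := by field_simp
      _ ≤ t * (e x / r x) := mul_le_mul_of_nonneg_right (hiso x hxA hxc) (div_nonneg (he0 x) hrx.le)
  have hrest : ∑ x ∈ A.erase c, e x ≤ t * (∑ x ∈ A, e x / r x - e c / r c) := by
    have hsplit : ∑ x ∈ A.erase c, e x / r x = ∑ x ∈ A, e x / r x - e c / r c := by
      rw [← Finset.add_sum_erase A _ hc]; ring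
    rw [← hsplit, Finset.mul_sum]
    exact Finset.sum_le_sum hterm
  -- (4) the champion term: Harris `e c ≤ μ(o↔c) · r c`
  have hharris : e c ≤ μ.real (openConn o c) * r c :=
    prodBernoulli_harris_upper_lower w (isUpperSet_openConn o c) (isLowerSet_notConn (A.erase c) c)
      MeasurableSet.of_discrete MeasurableSet.of_discrete
  have hrc : 0 < r c := hr0 c hc
  have hp1 : μ.real (openConn o c) ≤ 1 := measureReal_le_one
  -- (5) assemble
  have hsum : ∑ x ∈ A, e x = e c + ∑ x ∈ A.erase c, e x := (Finset.add_sum_erase A _ hc).symm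
  have h1 : ∑ x ∈ A, e x ≤ e c + t * (μ.real U - e c / r c) := by
    rw [hsum]
    have := mul_le_mul_of_nonneg_left (sub_le_sub_right hpack (e c / r c)) ht
    linarith [hrest]
  -- `e c + t (μU − e c / r c) = t μU + e c (1 − t / r c) ≤ t μU + μ(o↔c) r c (1 − t / r c)`
  have h2 : e c * (1 - t / r c) ≤ μ.real (openConn o c) * r c * (1 - t / r c) := by
    refine mul_le_mul_of_nonneg_right hharris ?_
    rw [sub_nonneg, div_le_one hrc]; exact htc
  have h3 : μ.real (openConn o c) * r c * (1 - t / r c) = μ.real (openConn o c) * r c - μ.real (openConn o c) * t := by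
    field_simp
  calc μ.real {ω : Set (Sym2 (Fin n)) | (A.filter fun a => ω ∈ openConn o a).card = 1}
      ≤ ∑ x ∈ A, e x := hcover
    _ ≤ e c + t * (μ.real U - e c / r c) := h1
    _ = t * μ.real U + e c * (1 - t / r c) := by field_simp; ring
    _ ≤ t * μ.real U + μ.real (openConn o c) * r c * (1 - t / r c) := by linarith [h2]
    _ = μ.real (openConn o c) * r c + (μ.real U - μ.real (openConn o c)) * t := by rw [h3]; ring

end Summit.CriticalPhenomena.PercolationContinuityZ3.Theorems

end
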